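import Mathlib
import HarnessLib
import Summits.HubbardSuperconductivity.HubbardSuperconductivity.Theorems.KLProgrammeKLRegimeSplitFlowPieceMeanOsc
import Summits.HubbardSuperconductivity.HubbardSuperconductivity.Theorems.KLProgrammeKLRegimeEngineV17F2ClosersCGQGuardDegenerate

/-!
# Route `KLProgramme` — ENGINE item stmt-HubbardSuperconductivity-20437, GAP G-005 «(C)-TADPOLE-NONVANISHING»: «MEAN-DOMINATES-OSCILLATION» ⇒ the
# scale-0 flow piece vanishes NOWHERE ⇒ the guarded Gfr-row of `hres′` (cell gate-hubbard-kl, seat p2 g27; pen (R432)(B))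

WHAT.  The tree's bridge `abs_evalM_klFlowPiece_sub_mean_le` (…SplitFlowPieceMeanOsc, the (R290) mean/oscillation split) says: if the scale-`m` cumulative reading
`ν_m = klLocalPart … (K_m) m` is `C⁴` and within `B` of its angular mean at every angle, then the flow piece is within `B` of that mean at EVERY momentum.  Hence the
second, torus-mean-free, sufficient condition for G-005 (beside `exists_evalM_klFlowPiece_zero_ne_zero`, ✓ p718115):
* **`evalM_klFlowPiece_ne_zero_of_mean_dominates`** — `μ ∈ klWindowC`, `ν_m ∈ C⁴`, `∀ θ, |ν_m θ − mean ν_m| ≤ B`, `B < |mean ν_m|` ⇒ `∀ q, evalM (klFlowPiece … m) q ≠ 0`;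
* **`exists_evalM_klFlowPiece_zero_ne_zero_of_mean_dominates`** — the `m = 0` instance in the `∃ q` shape of G-005;
* **`hresGuard_gfr_row_of_mean_dominates`** — composed with `hresGuard_gfr_row_of_tadpole` (✓ p715417): the guarded conjunct `1 ≤ n → 0 < R.Gfr 0` of the (C)
  closer's `hres′` for EVERY `R.WF2`, from «the scale-0 angular mean dominates the scale-0 angular oscillation».
So the scale-0 lane's remaining item is exactly the first-order statement «`ν₀(θ) = c_T·U + O(U²)` uniformly in `θ` with `c_T ≠ 0`» (mean `≥ c₁U − c₂U²`,
oscillation `≤ 2c₂U²`): the Hartree tadpole by `MatsubaraTadpole.sum_uvTadpole_ge` (✓ p717470) + a second-order remainder.  Pure composition of landed lemmas; nothing here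
asserts that statement, G-005, any row of 20437, K3, the Kohn–Luttinger margin or superconductivity.  0 kit · 0 lit.
References: BGM 2006 §3 (3.2)–(3.3) [cite: BenfattoGiulianiMastropietro2006].
-/

noncomputable section

namespace Summit.HubbardSuperconductivity.HubbardSuperconductivity.Theorems.EngineV8

set_option linter.dupNamespace false -- summit = problem name (single-conjunct summit), D-0017

open Real Literature.MathematicalPhysics.QuantumLattice Literature.Probability.LatticeModels
open Summit.HubbardSuperconductivity.HubbardSuperconductivity.Theorems.KLRegimeSplit
open Summit.HubbardSuperconductivity.HubbardSuperconductivity.Theorems.KLProgrammeLegKernels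
open Summit.HubbardSuperconductivity.HubbardSuperconductivity.Theorems.DispersionFlow

section Model

variable {L M : ℕ} [NeZero L] [NeZero M] {G : GeoConsts} {P : SplitConsts} {Q : EngConsts} {R : RenConsts} {β U μ : ℝ} {m n : ℕ}

/-- **MEAN DOMINATES OSCILLATION ⇒ THE FLOW PIECE VANISHES NOWHERE.** [cite: BenfattoGiulianiMastropietro2006, §3 (3.2)] -/
theorem evalM_klFlowPiece_ne_zero_of_mean_dominates (hμ : μ ∈ klWindowC)
    (hf : ContDiff ℝ 4 fun θ : ℝ => klLocalPart L M β U μ (klFlowFrameU L M β U μ m) m θ) {B : ℝ}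
    (hB : ∀ θ, |klLocalPart L M β U μ (klFlowFrameU L M β U μ m) m θ -
      klAngularMean (fun θ => klLocalPart L M β U μ (klFlowFrameU L M β U μ m) m θ)| ≤ B)
    (hdom : B < |klAngularMean (fun θ => klLocalPart L M β U μ (klFlowFrameU L M β U μ m) m θ)|) (q : Momentum) :
    evalM (klFlowPiece L M β U μ m) q ≠ 0 := by
  intro h0
  have h := abs_evalM_klFlowPiece_sub_mean_le hμ hf hB q
  rw [h0, zero_sub, abs_neg] at h
  exact absurd (h.trans_lt hdom) (lt_irrefl _)

/-- **G-005 shape at scale 0** (`K₀ = 0`): mean dominates oscillation ⇒ `∃ q, evalM (klFlowPiece … 0) q ≠ 0`. [cite: BenfattoGiulianiMastropietro2006, §3 (3.2)] -/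
theorem exists_evalM_klFlowPiece_zero_ne_zero_of_mean_dominates (hμ : μ ∈ klWindowC)
    (hf : ContDiff ℝ 4 fun θ : ℝ => klLocalPart L M β U μ 0 0 θ) {B : ℝ}
    (hB : ∀ θ, |klLocalPart L M β U μ 0 0 θ - klAngularMean (fun θ => klLocalPart L M β U μ 0 0 θ)| ≤ B)
    (hdom : B < |klAngularMean (fun θ => klLocalPart L M β U μ 0 0 θ)|) :
    ∃ q : Momentum, evalM (klFlowPiece L M β U μ 0) q ≠ 0 := by
  have h0 : klFlowFrameU L M β U μ 0 = 0 := rfl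
  have hf' : ContDiff ℝ 4 fun θ : ℝ => klLocalPart L M β U μ (klFlowFrameU L M β U μ 0) 0 θ := by rw [h0]; exact hf
  have hB' : ∀ θ, |klLocalPart L M β U μ (klFlowFrameU L M β U μ 0) 0 θ -
      klAngularMean (fun θ => klLocalPart L M β U μ (klFlowFrameU L M β U μ 0) 0 θ)| ≤ B := by rw [h0]; exact hB
  have hdom' : B < |klAngularMean (fun θ => klLocalPart L M β U μ (klFlowFrameU L M β U μ 0) 0 θ)| := by rw [h0]; exact hdom
  exact ⟨0, evalM_klFlowPiece_ne_zero_of_mean_dominates (m := 0) hμ hf' hB' hdom' 0⟩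

/-- **THE GUARDED Gfr-ROW OF `hres′` FROM «MEAN-DOMINATES-OSCILLATION» AT SCALE 0** (∘ `hresGuard_gfr_row_of_tadpole`, ✓ p715417): for every `R.WF2`.
[cite: BenfattoGiulianiMastropietro2006, §3 (3.2)–(3.3)] -/
theorem hresGuard_gfr_row_of_mean_dominates (hR : R.WF2) (hhist : HistP klPredsV17F2 L M G P Q R β U μ 0 n) (hμ : μ ∈ klWindowC)
    (hf : ContDiff ℝ 4 fun θ : ℝ => klLocalPart L M β U μ 0 0 θ) {B : ℝ}
    (hB : ∀ θ, |klLocalPart L M β U μ 0 0 θ - klAngularMean (fun θ => klLocalPart L M β U μ 0 0 θ)| ≤ B)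
    (hdom : B < |klAngularMean (fun θ => klLocalPart L M β U μ 0 0 θ)|) : 1 ≤ n → 0 < R.Gfr 0 :=
  hresGuard_gfr_row_of_tadpole hR hhist (exists_evalM_klFlowPiece_zero_ne_zero_of_mean_dominates hμ hf hB hdom)

end Model

end Summit.HubbardSuperconductivity.HubbardSuperconductivity.Theorems.EngineV8

end
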